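import Mathlib

/-!
# Eigen-weighted power-sum recovery (E2 of the decomp-langlands lens-1-g15 node `PrimeDegreeLadder`)

For a prime `p`, multisets `Γ i`, `A i` (`i : ZMod p`) of complex numbers of common size `n < p`, the identities
`∑ i, ζ ^ (i k) p_k(Γ i) = ∑ i, ζ ^ (i k) p_k(A i)` for every `p`-th root of unity `ζ` and every `1 ≤ k ≤ n` force
`Γ = A`: the characters of `ℤ/p` separate points (discrete Fourier inversion; `p ∤ k`), so the power sums
`p_1, …, p_n` of `Γ i` and `A i` agree, and Newton's identities plus Vieta recover the multiset.
This is the Mathlib-only statement `EigenWeightedPowerSumRecovery` of the node (E2 = BC3 stub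
`stub_eigenWeightedPowerSums` of the piece A `CubicLowRankDescent`, stmt-Langlands-27839, of route `TwistControlLadder`
rev 1), proved here with the node's binder list verbatim (census-1 g17, instrument I-L1g15.3 of the lens memo §7;
`--supports stmt-Langlands-27839`). Only Mathlib is imported.
-/

set_option linter.dupNamespace false

namespace Summit.Langlands.Langlands.Theorems.TwistControlLadderE2

open Finset Polynomial

/-- Fourier step: a function on `ZMod p` all of whose «root-of-unity moments» `∑ i, ω ^ i.val * c i` vanish is zero
(injectivity of the discrete Fourier transform `ZMod.dft`). -/
theorem eq_zero_of_forall_rootOfUnity_sum_eq_zero {p : ℕ} [NeZero p] (c : ZMod p → ℂ)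
    (h : ∀ ω : ℂ, ω ^ p = 1 → ∑ i : ZMod p, ω ^ i.val * c i = 0) : c = 0 := by
  have hF : ZMod.dft c = 0 := by
    funext j
    rw [ZMod.dft_apply, Pi.zero_apply]
    have hω : (ZMod.stdAddChar (-j : ZMod p)) ^ p = 1 := by
      rw [← AddChar.map_nsmul_eq_pow, nsmul_eq_mul, ZMod.natCast_self, zero_mul, AddChar.map_zero_eq_one]
    have key : ∀ i : ZMod p, ZMod.stdAddChar (-(i * j)) = (ZMod.stdAddChar (-j : ZMod p)) ^ i.val := by
      intro i
      rw [← AddChar.map_nsmul_eq_pow, nsmul_eq_mul, ZMod.natCast_zmod_val, mul_neg]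
    simp_rw [smul_eq_mul, key]
    exact h _ hω
  exact (LinearEquiv.map_eq_zero_iff ZMod.dft).mp hF

/-- Power-sum extraction: under the eigen-weighted identities the `k`-th power sums agree index by index
(`1 ≤ k ≤ n < p`): twist the root of unity by the inverse of `k` modulo `p`. -/
theorem powerSum_eq_of_eigenWeighted {p n : ℕ} [hp : Fact p.Prime] (hnp : n < p)
    (Γ A : ZMod p → Multiset ℂ)
    (h : ∀ ζ : ℂ, ζ ^ p = 1 → ∀ k : ℕ, 0 < k → k ≤ n →
      ∑ i : ZMod p, ζ ^ (i.val * k) * ((Γ i).map (· ^ k)).sum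
        = ∑ i : ZMod p, ζ ^ (i.val * k) * ((A i).map (· ^ k)).sum)
    (k : ℕ) (hk : 0 < k) (hkn : k ≤ n) (i : ZMod p) :
    ((Γ i).map (· ^ k)).sum = ((A i).map (· ^ k)).sum := by
  have hpp : p.Prime := hp.out
  have hkp : Nat.Coprime k p :=
    (Nat.coprime_comm.mp (hpp.coprime_iff_not_dvd.mpr (Nat.not_dvd_of_pos_of_lt hk (lt_of_le_of_lt hkn hnp))))
  obtain ⟨m, -, hm⟩ := Nat.exists_mul_mod_eq_one_of_coprime hkp hpp.one_lt
  have hkm : k * m = p * (k * m / p) + 1 := by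
    have := Nat.div_add_mod (k * m) p
    omega
  set c : ZMod p → ℂ := fun j => ((Γ j).map (· ^ k)).sum - ((A j).map (· ^ k)).sum with hc
  have hzero : c = 0 := by
    apply eq_zero_of_forall_rootOfUnity_sum_eq_zero
    intro ω hω
    have hζp : (ω ^ m) ^ p = 1 := by rw [← pow_mul, mul_comm, pow_mul, hω, one_pow]
    have hζ : ∀ j : ZMod p, (ω ^ m) ^ (j.val * k) = ω ^ j.val := by
      intro j
      have e : m * (j.val * k) = p * (j.val * (k * m / p)) + j.val := by
        calc m * (j.val * k) = j.val * (k * m) := by ring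
          _ = j.val * (p * (k * m / p) + 1) := by rw [← hkm]
          _ = p * (j.val * (k * m / p)) + j.val := by ring
      rw [← pow_mul, e, pow_add, pow_mul, hω, one_pow, one_mul]
    have hh := h (ω ^ m) hζp k hk hkn
    simp_rw [hζ] at hh
    simp_rw [hc, mul_sub, Finset.sum_sub_distrib, hh, sub_self]
  have := congrFun hzero i
  simpa [hc, sub_eq_zero] using this

/-- Newton–Vieta step: two multisets of complex numbers of the same size `n` with equal power sums
`p_1, …, p_n` are equal. -/
theorem multiset_eq_of_powerSum_eq (n : ℕ) (s t : Multiset ℂ) (hs : Multiset.card s = n)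
    (ht : Multiset.card t = n)
    (h : ∀ k : ℕ, 0 < k → k ≤ n → (s.map (· ^ k)).sum = (t.map (· ^ k)).sum) : s = t := by
  classical
  -- elementary symmetric functions agree up to degree n (Newton's identities, strong induction)
  have hes : ∀ j, j ≤ n → s.esymm j = t.esymm j := by
    -- Newton's identity for a multiset `u` of size `n`, read through the tautological indexing `u → ℂ`
    -- power sums through the tautological indexing `u → ℂ`
    have hps : ∀ (u : Multiset ℂ) (k : ℕ), ∑ x : u, (x : ℂ) ^ k = (u.map (· ^ k)).sum := by
      intro u k
      rw [Finset.sum_eq_multiset_sum]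
      conv_rhs => rw [← Multiset.map_univ_coe u]
      simp only [Multiset.map_map, Function.comp_def]
    have newton : ∀ (u : Multiset ℂ), ∀ j : ℕ,
        (j : ℂ) * u.esymm j = (-1) ^ (j + 1) *
          ∑ a ∈ (antidiagonal j).filter (fun a => a.1 < j),
            (-1) ^ a.1 * u.esymm a.1 * (u.map (· ^ a.2)).sum := by
      intro u j
      have key := congrArg (MvPolynomial.aeval (fun x : u => (x : ℂ))) (MvPolynomial.mul_esymm_eq_sum u ℂ j)
      simp only [map_mul, map_natCast, map_pow, map_neg, map_one, map_sum,
        MvPolynomial.aeval_esymm_eq_multiset_esymm, Multiset.map_univ_coe,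
        MvPolynomial.psum, MvPolynomial.aeval_X, hps] at key
      exact key
    intro j
    induction j using Nat.strong_induction_on with
    | _ j ih =>
      intro hj
      rcases Nat.eq_zero_or_pos j with rfl | hjpos
      · simp [Multiset.esymm, Multiset.powersetCard_zero_left]
      · have hsN := newton s j
        have htN := newton t j
        have hsum : (∑ a ∈ (antidiagonal j).filter (fun a => a.1 < j),
              (-1 : ℂ) ^ a.1 * s.esymm a.1 * (s.map (· ^ a.2)).sum)
            = ∑ a ∈ (antidiagonal j).filter (fun a => a.1 < j),
              (-1 : ℂ) ^ a.1 * t.esymm a.1 * (t.map (· ^ a.2)).sum := by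
          apply Finset.sum_congr rfl
          intro a ha
          simp only [Finset.mem_filter, Finset.HasAntidiagonal.mem_antidiagonal] at ha
          obtain ⟨hadd, hlt⟩ := ha
          rw [ih a.1 hlt (by omega), h a.2 (by omega) (by omega)]
        have hj0 : (j : ℂ) ≠ 0 := Nat.cast_ne_zero.mpr (Nat.pos_iff_ne_zero.mp hjpos)
        have := hsN.trans ((congrArg _ hsum).trans htN.symm)
        exact mul_left_cancel₀ hj0 this
  -- Vieta: the monic polynomials with root multisets s and t coincide, hence so do s and t
  have hprod : (s.map fun a => X - C a).prod = (t.map fun a => X - C a).prod := by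
    rw [Multiset.prod_X_sub_X_eq_sum_esymm, Multiset.prod_X_sub_X_eq_sum_esymm, hs, ht]
    apply Finset.sum_congr rfl
    intro j hj
    rw [Finset.mem_range] at hj
    rw [hes j (by omega)]
  have := congrArg Polynomial.roots hprod
  rwa [Polynomial.roots_multiset_prod_X_sub_C, Polynomial.roots_multiset_prod_X_sub_C] at this

/-- **E2 — eigen-weighted power-sum recovery** (the node's `EigenWeightedPowerSumRecovery`, binders verbatim):
for a prime `p`, `n < p`, and multisets `Γ i`, `A i` (`i : ZMod p`) of complex numbers of size `n`, the identities
`∑ i, ζ^(i.val·k) p_k(Γ i) = ∑ i, ζ^(i.val·k) p_k(A i)` for all `p`-th roots of unity `ζ` and all `1 ≤ k ≤ n` force `Γ = A`. -/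
theorem eigenWeightedPowerSumRecovery :
    ∀ (p n : ℕ) [Fact p.Prime], n < p →
      ∀ (Γ A : ZMod p → Multiset ℂ), (∀ i, Multiset.card (Γ i) = n) → (∀ i, Multiset.card (A i) = n) →
        (∀ ζ : ℂ, ζ ^ p = 1 → ∀ k : ℕ, 0 < k → k ≤ n →
            ∑ i : ZMod p, ζ ^ (i.val * k) * ((Γ i).map (· ^ k)).sum
              = ∑ i : ZMod p, ζ ^ (i.val * k) * ((A i).map (· ^ k)).sum) →
        Γ = A := by
  intro p n _ hnp Γ A hΓ hA h
  funext i
  exact multiset_eq_of_powerSum_eq n (Γ i) (A i) (hΓ i) (hA i)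
    (fun k hk hkn => powerSum_eq_of_eigenWeighted hnp Γ A h k hk hkn i)

end Summit.Langlands.Langlands.Theorems.TwistControlLadderE2
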